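import Mathlib
import HarnessLib
import HarnessLib.Audit
import Summits.AtomisticToContinuum.Statement

/-!
Route: BECSwapOverlap

CLOSED (retired) 2026-08-15T13:40:50Z by operator:999:1257524 — reason: not-a-thesis: assembly does not conclude the sub-problem Statement — note: D-0027 §2.1 audit (human 2026-08-15: routes that do not decide the summit are removed): the assembly concludes `Literature.MathematicalPhysics.QuantumManyBody.BoseGas.BoseEinsteinCondensation`, not the sub-problem statement; a NEW conforming route may be opened from the same idea (generated `closes . The file is kept as the record of this route; refuted decls are indexed as negative knowledge (`ledger negatives`).

# Route BECSwapOverlap — BEC as absence of an orthogonality catastrophe for the one-pair swap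
between two copies (Penrose–Onsager II as a ground-state fidelity)

It suffices to show X = SwapOverlapBound (card swap-overlap-no-catastrophe, its item S2 in
phase-blind, needle-robust form): for every
repulsive finite-range v there is ρ₀ > 0 such that for 0 < ρ < ρ₀ there is c > 0 with: for all large
N = n+1 there is δ > 0 such that
EVERY δ-near-minimiser Ψ of the Dirichlet N-body energy in the box of side L = (N/ρ)^(1/3) has
two-copy swap overlap
SWAP(Ψ) := ∫∫ dY dY′ |⟨Ψ(·,Y′), Ψ(·,Y)⟩_(L²(dx))|² ≥ c. Exact identities: SWAP(Ψ) = tr(γ_Ψ²)/N²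
(Penrose–Onsager's A₂, criterion II)
= ⟨Ψ⊗Ψ, F(Ψ⊗Ψ)⟩ with F the transposition x₁ ↔ y₁ between two INDEPENDENT copies (HerdmanEtAl2014's
swap estimator). Mode-free, so the
Dirichlet boundary layer is harmless. Frame: λ_max(γ_Ψ) ≥ tr γ²/tr γ = N·SWAP(Ψ) (support
PenroseOnsagerII, elementary: average the occupations
of the normalised modes φ_Y′ = Ψ(·,Y′)/‖Ψ(·,Y′)‖ with weights ‖Ψ(·,Y′)‖²), uniformly over
δ-near-minimisers ⇒ condensateNumber ≥ cN
(le_condensateNumber) ⇒ HasGroundStateBEC v ρ ⇒ the conjunct. The ENGINE is the card's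
orthogonality-catastrophe reading: for the ground state
Φ(0) = Ψ₀⊗Ψ₀ of H⊕H, SWAP(Ψ₀) = ⟨Φ(0), FΦ(0)⟩ is the overlap of the ground states of H⊕H and of
F(H⊕H)F = H⊕H + D, D = Σ_(j≥2)[v(y₁−x_j) −
v(x₁−x_j) + v(x₁−y_j) − v(y₁−y_j)] the LOCAL one-pair swap defect; along the stoquastic path H(s) =
H⊕H + sD (tagged pair coupled with strength
1−s to its own copy and s to the other; F H(s) F = H(1−s); positive unique ground states Φ(s),
F-even at s = ½) one has the midpoint lemma
SWAP ≥ 2|⟨Φ(0),Φ(½)⟩|² − 1 and the chord bound 1 − |⟨Φ(s),Φ(s′)⟩|² ≤ (sup_s χ_F)(s−s′)², χ_F(s) =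
‖(H(s)−E(s))⁻¹Q D Φ(s)‖² the fidelity
susceptibility of the defect; the cruxes assert these overlaps stay near 1 uniformly in N at small ρ
(bounded v), i.e. NO orthogonality
catastrophe for exchanging (half of) the dressing clouds of one particle pair — super-ohmic spectral
weight of density fluctuations in d = 3.
Lean: `∀ v : ℝ → ENNReal,
Literature.MathematicalPhysics.QuantumManyBody.BoseGas.IsRepulsiveFiniteRange v → ∃ ρ₀ : ℝ, 0 < ρ₀ ∧
∀ ρ : ℝ, 0 < ρ → ρ < ρ₀ → ∃ c : ℝ, 0 < c ∧ ∀ᶠ n : ℕ in Filter.atTop, ∃ δ : ENNReal, 0 < δ ∧ ∀ Ψ :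
Literature.MathematicalPhysics.QuantumManyBody.BoseGas.TrialState (n + 1)
(Literature.MathematicalPhysics.QuantumManyBody.BoseGas.sideLength ρ (n + 1)),
Literature.MathematicalPhysics.QuantumManyBody.BoseGas.energy v Ψ ≤
Literature.MathematicalPhysics.QuantumManyBody.BoseGas.groundStateEnergy v (n + 1)
(Literature.MathematicalPhysics.QuantumManyBody.BoseGas.sideLength ρ (n + 1)) + δ → ENNReal.ofReal c
≤ ∫⁻ Y : Literature.MathematicalPhysics.QuantumManyBody.BoseGas.Config n, ∫⁻ Y' :
Literature.MathematicalPhysics.QuantumManyBody.BoseGas.Config n, (‖∫ x, (starRingEnd ℂ) (Ψ.ψ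
(Matrix.vecCons x Y')) * Ψ.ψ (Matrix.vecCons x Y)‖₊ : ENNReal) ^ 2`

## Assembly
Pure logic plus two library lemmas: fix v, hv; SwapOverlapBound gives ρ₀; for 0 < ρ < ρ₀ get c and
an eventual set of n with δ(n);
for N = n+1 in that set (shift the atTop filter by one) and every δ-near-minimiser Ψ,
PenroseOnsagerII gives maxOccupation N Ψ.ψ ≥ N·SWAP(Ψ) ≥
N·ofReal c = ofReal(c·N); le_condensateNumber (δ > 0) turns the uniform bound into condensateNumber
v N L ≥ ofReal(c·N); this is
HasGroundStateBEC v ρ with constant c, hence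
Literature.MathematicalPhysics.QuantumManyBody.BoseGas.BoseEinsteinCondensation (= the audited
conjunct, by rfl).

Rationale: WHY THIS LINE. Mechanism: Penrose–Onsager criterion II made into a ground-state FIDELITY problem for
an explicit one-parameter family of honest 2N-body
Schrödinger operators (PenroseOnsager1956 §4 (5)–(7); swap estimator HerdmanEtAl2014,
HerdmanDelmaestro2015). Imported areas, with dictionary:
rigorous Anderson-orthogonality spectral theory (Anderson1967; GebertKuttlerMuller2014,
GebertEtAl2016, DietleinGebertMuller2019: overlap exponent =
Hilbert–Schmidt/spectral-shift norm of the defect — there fermionic/one-body, here a norm-O(1)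
two-body defect D in an interacting Bose system, with
the GOOD sign: no Fermi surface, defect spectral function ∝ ω³ in d = 3), Bose-polaron residue
physics (GuentherEtAl2021: catastrophe for impurities
in the IDEAL condensate and in d = 1, none in the interacting 3-D gas; MysliwySeiringer2020 for the
rigorous mean-field polaron), quantum-information
fidelity susceptibility (chord bound = Fubini–Study length), and the Eisenberg–Lieb SU(2) point
(EisenbergLieb2002: for the two-SPECIES mixture
H_A+H_B+λV_AB the same functional ⟨F⟩_λ equals 1 at λ = 1) as calibration of the family. What it
does that prior routes do not: it is mode-free
and Dirichlet-native (BECInfraredBound/BECPinning/BECPeriodicReduction commit to the constant mode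
or to a BC transfer), never converts energy into
depletion (no L²×excess-energy step: BECPinning, KineticGap routes), and versus the sibling
positivity lines (route BECPalmLandscape: static Jensen on the
conditional-density landscape; card swap-affinity-insertion-variance: Jeffreys divergence of −log
Ψ₀) it replaces the implicit object log Ψ₀ by the
explicit defect D (differences of v) and a path of ground states, so its inputs are SPECTRAL
(low-frequency weight of density fluctuations:
S(k) ≲ |k| and ω(k) ≳ |k| down to k ~ 1/L) rather than the fine structure of log Ψ₀. Negatives index
empty at filing.

RANKED CRUXES. #0 SwapOverlapBound (target) — X as in § Thesis: uniform lower bound c > 0 on the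
two-copy swap overlap SWAP(Ψ) = tr(γ_Ψ²)/N² of δ-near-minimisers of the Dirichlet N-body energy (N =
n+1, L = (N/ρ)^(1/3)), for every repulsive finite-range v (hard cores included) at all small
densities. Equivalent, near-minimiser by near-minimiser, to λ_max(γ_Ψ) ≥ c′N (P–O II both ways:
(λ_max/N)² ≤ SWAP ≤ λ_max/N). (why it might fail: Equivalent to ground-state BEC itself at the level
of near-minimisers (PenroseOnsager1956 (5)); fails iff the T = 0 conjunct fails. For hard cores the
prover must also secure E₀ < ⊤ at ρ < ρ₀(v) (else every Ψ is a near-minimiser).)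
[PenroseOnsager1956, LiebSeiringerSolovejYngvason2005, HerdmanEtAl2014]
#2 SwapPathRigidity (crux) — NO ORTHOGONALITY CATASTROPHE ALONG THE SWAP PATH (card S2/S3 in
fidelity form; bounded finite-range v). Two copies of the box Λ_L^N (N = n+1, L = (N/ρ)^(1/3)); tag
particle 0 of each copy (a = x₀, b = y₀). For s ∈ [0,1] let E2(s) be the Dirichlet quadratic form on
Λ^N × Λ^N with potential W_s = [bath A pairs] + [bath B pairs] + Σ_(j≥1) (1−s)(v(a−x_j) + v(b−y_j))
+ s(v(b−x_j) + v(a−y_j)) (H(0) = H⊕H, H(1) = F H(0) F, H(s) stoquastic, F H(s) F = H(1−s)). Claim: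
for every ε > 0 there is ρ₀(ε,v) > 0 such that for 0 < ρ < ρ₀, all large n, all s, s′ ∈ [0,1] and
every τ > 0 there is δ > 0 with: any δ-near-minimisers Θ of E2(s) and Θ′ of E2(s′) (C¹, Dirichlet,
normalised) satisfy |⟨Θ,Θ′⟩|² ≥ 1 − ε(s−s′)² − τ. Ground-state reading: the positive ground states
Φ(s) move with Fubini–Study speed ≤ √ε, i.e. sup_s χ_F(s) → 0 as ρ → 0 UNIFORMLY IN N (Bogoliubov
count: χ_F ≈ ρ∫d³k |v̂(k)|² S(k)/(ω_A(k)+ω_B(k))² + O(√(ρa³)) ≈ C(∫v)²√(ρ/a): integrand ∝ k dk at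
small k in d = 3, dk/k in d = 1). At (s,s′) = (0,1) it gives SWAP(Ψ₀)² = |⟨Φ(0),FΦ(0)⟩|² ≥ 1 − ε:
complete condensation in the dilute limit. [deps: none] [difficulty: open-problem] [difficulty:
open-problem] (why it might fail: Asserts a fidelity susceptibility bounded uniformly down to k~π/L:
needs inverse-square spectral moments of density fluctuations, i.e. a Landau-type lower bound ω(k) ≳
|k| at thermodynamic scales (open beyond GP scaling, Seiringer2011) plus control beyond 2nd order
(GN pair channel).) [Anderson1967, GebertKuttlerMuller2014, GebertEtAl2016, GuentherEtAl2021,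
Seiringer2011, Literature.Barriers.AtomisticToContinuum.BogoliubovPerturbationInfrared,
Literature.Barriers.AtomisticToContinuum.KineticGapLengthScales]
#3 HalfSwapOverlap (crux) — THE HALF-SWAPPED GROUND STATE REMEMBERS THE PRODUCT (integrated AOC
statement; bounded finite-range v). With E2(½) the F-SYMMETRIC midpoint form of crux 2 (each tagged
particle coupled at half strength to BOTH baths): there are ρ₀(v) > 0 and, for 0 < ρ < ρ₀, some η >
0 such that for all large n there is δ > 0 with: for every δ-near-minimiser Ψ of the one-copy
Dirichlet energy and every F-symmetric (Θ∘F = Θ, F: x₀ ↔ y₀), C¹, Dirichlet, normalised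
δ-near-minimiser Θ of E2(½) within the F-symmetric class, |⟨Θ, Ψ⊗Ψ⟩|² ≥ ½ + η. Midpoint lemma (pure
Hilbert-space algebra, F a unitary involution, Θ F-invariant unit vector): ⟨Φ,FΦ⟩ ≥ 2|⟨Θ,Φ⟩|² − 1,
so this crux gives SWAP(Ψ) ≥ 2η for bounded v with NO spectral input in the glue; it is implied by
crux 2 (chord from s = 0 to ½) given the fixed-(n,L) Perron–Frobenius facts. Ground-state reading:
α² = |⟨Ψ₀⊗Ψ₀, Φ(½)⟩|² > ½ — two independent condensates and the system in which one pair is shared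
half-half cannot be told apart (expected 1 − α² = O(C(v)√ρ)). [deps: none] [difficulty:
open-problem] [difficulty: open-problem] (why it might fail: No uniform-in-N overlap of 2N-body
ground states differing by an O(1) local defect has ever been controlled for an interacting
continuum gas; two gapless baths; if 1−α² keeps a v-dependent O(1) piece as ρ→0 (UV of the
half-coupled pair) the ½ threshold is missed.) [Anderson1967, GebertKuttlerMuller2014,
GuentherEtAl2021, EisenbergLieb2002, PenroseOnsager1956]
#4 StaticImpurityRigidity (crux) — FIRST RUNG: NO CATASTROPHE FOR A STATIC IMPURITY IN THE DILUTE
INTERACTING GAS, UNIFORMLY IN THE VOLUME (bounded finite-range v). One copy, Dirichlet box, N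
bosons, plus a static impurity at z ∈ ℝ³ coupled through the SAME pair potential with strength t:
E_t(Θ) = energy v Θ + t∫Σ_j v(z−x_j)|Θ|². Claim: for every ε > 0 there is ρ₀(ε,v) such that for 0 <
ρ < ρ₀, all large N, all z, all t,t′ ∈ [0,1] and every τ > 0 there is δ > 0 with: δ-near-minimisers
Θ of E_t and Θ′ of E_t′ (in TrialState N L) satisfy |⟨Θ,Θ′⟩|² ≥ 1 − ε(t−t′)² − τ. Ground-state
reading: the infinite-mass Bose-polaron residue Z_N(z,t) → 1 as ρ → 0 uniformly in N and z
(displaced-phonon exponent ρ∫d³k|v̂(k)|²S(k)/ω(k)² ∝ (∫v)²√(ρ/a) in d = 3; it DIVERGES for the ideal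
gas (S ≡ 1, ω = k²) and in d = 1 — so any proof must use the hyperuniformity of the interacting
ground state quantitatively). The worst case of the engine (no recoil, one bath); test-bed for the
technology of cruxes 2–3, not on the assembly path. [deps: none] [difficulty: XL] [difficulty: XL]
(why it might fail: True for the ideal gas it is NOT (GuentherEtAl2021): the bound must come from
S(k)≲|k| and ω(k)≳|k| of the interacting gas down to k~π/L, an O(1)-precision inhomogeneous response
estimate inside an O(N) energy — no such uniform-in-L estimate exists.) [GuentherEtAl2021,
MysliwySeiringer2020, Anderson1967, PitaevskiiStringari1991,
Literature.Barriers.AtomisticToContinuum.KineticGapLengthScales]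
#9 PenroseOnsagerII (support) — P–O criterion II in variational clothing: for every N = n+1, L and
every admissible Ψ, (n+1)·SWAP(Ψ) ≤ maxOccupation (n+1) Ψ.ψ, i.e. λ_max(γ) ≥ tr γ²/tr γ. Proof: for
each Y′ with w(Y′) = ‖Ψ(·,Y′)‖² > 0 the normalised mode φ_Y′ = Ψ(·,Y′)/√w(Y′) has occupation
(n+1)·g(Y′)/w(Y′), g(Y′) = ∫dY |⟨Ψ(·,Y′),Ψ(·,Y)⟩|²; hence g ≤ w·maxOcc/(n+1) pointwise (g = 0 where
w = 0 by continuity), and Tonelli + ∫w = 1 give SWAP = ∫g ≤ maxOcc/(n+1). No spectral theorem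
needed. [difficulty: provable-now] [difficulty: provable-now] [PenroseOnsager1956,
LiebSeiringerSolovejYngvason2005]

TWO-LAYER PLAN. Foreseen glued splits (nothing filed now): SwapOverlapBound ⇐ HalfSwapOverlap →
HardCoreSoftening → SwapOverlapBound (glue = midpoint lemma
⟨Φ,FΦ⟩ ≥ 2|⟨Θ,Φ⟩|²−1 + Fubini SWAP = ⟨Ψ⊗Ψ,FΨ⊗Ψ⟩ + existence of F-symmetric near-minimisers;
HardCoreSoftening = extension from bounded v to
v with hard core by a Dyson-lemma softening or a direct positivity argument); HalfSwapOverlap ⇐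
SwapPathRigidity → TwoCopyPerronFrobenius →
HalfSwapOverlap (fixed-(n,L) facts: bosonic inf = absolute inf, F-symmetric inf = absolute inf at s
= ½, near-minimisers → e^(iθ)Φ(s));
SwapPathRigidity ⇐ SpectralInput (S_N(k) ≤ C|k| and a Landau-type lower bound on the energy of
density excitations down to k ~ π/L, giving the
inverse-square moment Σ_m|⟨m|D|Φ(s)⟩|²/(E_m−E(s))² ≤ C(v)√ρ) → AdiabaticDomination (second order
controls the path: the card's 'cumulant
domination') → SwapPathRigidity, once vocabulary for excited states / reduced resolvents exists.

KILL CRITERIA. (i) A computation or theorem showing the swap-defect fidelity susceptibility grows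
with L in d = 3 (log L or a power, e.g. through the
Gavoret–Nozières pair channel or a Dirichlet surface mode) refutes SwapPathRigidity; if the growth
is intrinsic to s ∈ (0,½] the whole engine dies —
close refuted:SwapPathRigidity unless HalfSwapOverlap survives by a non-differential argument. (ii)
¬HalfSwapOverlap while BEC is still expected
(overlap with the half-swapped ground state ≤ ½ although S > 0) means the AOC reading is wrong:
close refuted:HalfSwapOverlap. (iii)
¬StaticImpurityRigidity (a catastrophe for a static impurity in the interacting dilute gas,
uniformly in L) falsifies the super-ohmic premise in
the Dirichlet box: close. (iv) ¬SwapOverlapBound is ¬BEC for near-minimisers — it kills the T = 0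
conjunct, not just the route (hand to the
negatives index). Mooted if any route proves HasGroundStateBEC (X ⇔ BEC near-minimiser-wise).

NOT DECOMPOSED YET. Hard cores (v = ⊤·1_[0,a] is admissible in the conjunct; cruxes 2–4 assume
bounded v — layer-2 child HardCoreSoftening); the two glues named in
the two-layer plan (midpoint lemma; Perron–Frobenius identification of near-minimisers at fixed n,
L); the reduction of SwapPathRigidity to
spectral inputs (hyperuniformity + Landau-type bound ⇒ inverse-square moment ⇒ adiabatic domination)
— the card's S3, informal until a
vocabulary for excited states exists; the torus version (feeds BECPeriodicReduction.PeriodicBEC via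
λ_max ≥ tr γ²/N); the Eisenberg–Lieb λ-family
(two-species mixture, ⟨F⟩_λ=1 = 1) — calibration only, since d⟨F⟩/dλ is a cross-susceptibility with
a soft spin mode near λ = 1; T > 0.

CHEAPEST FALSIFIER. Pen-and-paper/kit Bogoliubov computation of the fidelity susceptibility of the
swap defect D = Σ_j[v(y₀−x_j) − v(x₀−x_j) + v(x₀−y_j) − v(y₀−y_j)]
for two copies of the Bogoliubov ground state in the box/torus of side L at fixed ρa³ ∈ [10⁻⁴,10⁻²]:
χ_F(L) = Σ_(m≠0)|⟨m|D|0⟩|²/(E_m−E₀)² must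
CONVERGE as L → ∞ to ≈ C(∫v)²√(ρ/a) (my count: single-phonon channel ρΣ_k|v̂|²S(k)/(ω_A+ω_B)²,
summand ∝ k; native-cloud channel O(√(ρa³))). A log L
(pair channel k,−k with denominator 2ω_k, or the surface mode) kills crux 2 and makes crux 3
suspect. Calibration: the same sum in d = 1 must
diverge like log L (Lieb–Liniger/Tonks: tr γ²/N² → 0, HerdmanDelmaestro2015), and the PIGS swap
estimator of HerdmanEtAl2014 for 3-D soft spheres
at ρa³ = 10⁻³, N = 64…512 must saturate near (1 − 1.5√(ρa³))². Not run here (hub is compute-free; no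
kit in plancard mode).

NUMBERS. Bogoliubov: condensate fraction 1 − (8/(3√π))√(ρa³), so SWAP ≈ n₀² ≈ 1 − 3.0√(ρa³) (ρa³ =
10⁻³: SWAP ≈ 0.905); healing length ξ = (8πρa)^(-1/2),
sound speed c = √(16πρa) (ħ = 2m = 1); defect fidelity susceptibility χ_F ≈ C(∫v)²√(ρ/a) at fixed v
(→ 0 as ρ → 0, the small parameter of
cruxes 2–4); d = 1 Tonks gas: λ_max ~ √N (Lenard1964, ForresterFrankelGaroni2003) so SWAP ≤ λ_max/N
→ 0. Items at open: 6 (1 target, 3 cruxes,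
1 support, 1 assembly).

DEFINITION REQUESTS. None blocking: the two-copy / impurity energies are inlined with `let` in the
signatures (all elaborate, Sketch.lean rc 0). Desirable later:
(a) a problem-side vocabulary `TwoCopy` (two-copy trial states, swap map F, s-coupled energy E2(s))
under
Summits/AtomisticToContinuum/BoseEinsteinCondensation/Theorems to shorten cruxes 2–3 and their glue;
(b) a Literature vocabulary for excited
states of the Dirichlet N-body form (reduced resolvent / spectral measure of a vector, dynamic
structure factor S(k,τ)) needed to TYPE the
spectral input of the two-layer plan; (c) cite fact wanted: EisenbergLieb2002 main theorem
(species-blind interaction ⇒ fully polarised ground state).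

Novelty: Searches (2026-08-15): `lit frontier AtomisticToContinuum --since 2020` (30 rows; BEC side:
arXiv:2603.20776, arXiv:2510.20493, arXiv:2602.16566 —
energy/localisation currency only); `lit bridges AtomisticToContinuum --cross any` (30 rows, none on
Bose-gas overlaps); `lit search --source crossref`
×7 ("orthogonality catastrophe impurity Bose-Einstein condensate" → doi:10.1103/physreva.103.013317,
doi:10.1103/physreva.63.013609; "Anderson
orthogonality catastrophe bosons rigorous spectral" → doi:10.4171/jst/135, doi:10.4171/jst/267;
"fidelity susceptibility impurity Bose gas
orthogonality" → Soda 1964, Petković 2022 (1-D); "polarization of interacting bosons with spin" →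
doi:10.1103/physrevlett.89.220403; "particle
partition entanglement bosons … swap" → doi:10.1103/physrevb.91.184507; "ground-state overlap
adiabatic fidelity susceptibility bound" → Gu 2009
doi:10.1103/physreve.79.061125; "orthogonality catastrophe superohmic phonon bath" → Castella 1996,
Knap et al. 2012); `lit galaxy search
"orthogonality catastrophe" --star pdf` (8 hits, X-ray-edge/Kondo/1-D physics), `--star all` long
phrase (0), panama queue saturated; `lit vsearch`
(textbooks only); local searchd index unavailable this session (ConnectionReset), OpenAlex 429.
In-pool: card swap-affinity-insertion-variance and
route BECPalmLandscape (static Jensen/affinity), audit-13 of this card (HerdmanEtAl2014 swap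
estimator known; architecture new).
Nearest prior art found: PenroseOnsager1956 §4 (5)–(7) (criterion II)  [refs: 10.1103/physreva.103.013317, 10.1103/physreva.63.013609, 10.4171/jst/135, 10.4171/jst/267, 10.1103/physrevlett.89.220403, 10.1103/physrevb.91.184507, 10.1103/physreve.79.061125, 2603.20776, 2510.20493, 2602.16566, doi:10.1103/physreva.103.013317, doi:10.1103/physreva.63.013609, doi:10.4171/jst/135, doi:10.4171/jst/267, doi:10.1103/physrevlett.89.220403, doi:10.1103/physrevb.91.184507, doi:10.1103/]

Barriers (technique_class: AOC-overlap two-copy-swap fidelity-susceptibility): - technique_class: AOC-overlap two-copy-swap fidelity-susceptibility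
- Literature.Barriers.AtomisticToContinuum.KineticGapLengthScales: evaded in the statements — no
step bounds depletion by (box side)²×(excess energy); L enters only as the infrared end k ≥ π/L of
an inverse-square spectral moment that converges in d = 3 with one power to spare (∫k dk); honest
caveat: the layer-2 spectral input needs a Landau-type lower bound on density-excitation energies
down to k ~ π/L, and if the only road to it is gap bookkeeping the barrier re-enters there
(why-might-fail of crux 2).
- Literature.Barriers.AtomisticToContinuum.EnergyAsymptoticsWithoutCondensation: evaded — no energy
asymptotics are matched; the objects are overlaps of ground states; the 1-D Lieb–Liniger witness
sits on the right side (ohmic defect ⇒ catastrophe ⇒ SWAP → 0, no BEC claimed).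
- Literature.Barriers.AtomisticToContinuum.BogoliubovPerturbationInfrared: partially applies — a
bare expansion of Φ(s) in v meets the T = 0 infrared problem (Gavoret–Nozières pair channel); the
route's quantities are second-order responses to a gauge-invariant LOCAL density coupling, IR-finite
by power counting in d = 3, and the non-perturbative step (adiabatic domination beyond second order)
is exactly the open content of crux 2, flagged in its why-might-fail; the cheapest falsifier tests
the pair channel first.
- Literature.Barriers.AtomisticToContinuum.PitaevskiiStringariOneDimension: respected and used — the
dimension test is the

History (route lifecycle, newest last):
- 2026-08-15T13:40:50Z · CLOSED retired — not-a-thesis: assembly does not conclude the sub-problem Statement (operator:999:1257524)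

sub-problem: BoseEinsteinCondensation · status: closed(retired) · opened planner-plancard-AtomisticToContinuum-BoseEin-a26c992a-0 2026-08-15T11:25:44Z · rev 0 · ledger route-AtomisticToContinuum-BECSwapOverlap
GENERATED by the gate from the ledger (D-0016/17). Provers cite these decls: `theorem foo : Summit.AtomisticToContinuum.BoseEinsteinCondensation.Theses.BECSwapOverlap.<Decl> := …` in Summits/AtomisticToContinuum/BoseEinsteinCondensation/Theorems/<Name>.lean.
-/

namespace Summit.AtomisticToContinuum.BoseEinsteinCondensation.Theses.BECSwapOverlap

open scoped BigOperators Topology Manifold Classical MeasureTheory ProbabilityTheory Matrix InnerProductSpace ComplexConjugate ContinuousMap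
open Filter Set Function TopologicalSpace MeasureTheory

attribute [summit_statement] _root_.BoseEinsteinCondensation

/-- item stmt-AtomisticToContinuum-3893 · target · rank 0 · closed · moot by None · by planner
why it might fail: Equivalent to ground-state BEC itself at the level of near-minimisers (PenroseOnsager1956 (5)); fails iff the T = 0 conjunct fails. For hard cores the prover must also secure E₀ < ⊤ at ρ < ρ₀(v) (else every Ψ is a near-minimiser).
sources: PenroseOnsager1956, LiebSeiringerSolovejYngvason2005, HerdmanEtAl2014
[target] X as in § Thesis: uniform lower bound c > 0 on the two-copy swap overlap SWAP(Ψ) =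
tr(γ_Ψ²)/N² of δ-near-minimisers of the Dirichlet N-body energy (N = n+1, L = (N/ρ)^(1/3)), for
every repulsive finite-range v (hard cores included) at all small densities. Equivalent,
near-minimiser by near-minimiser, to λ_max(γ_Ψ) ≥ c′N (P–O II both ways: (λ_max/N)² ≤ SWAP ≤
λ_max/N). -/
@[route_item "route-AtomisticToContinuum-BECSwapOverlap"]
def SwapOverlapBound : Prop :=
  ∀ v : ℝ → ENNReal, Literature.MathematicalPhysics.QuantumManyBody.BoseGas.IsRepulsiveFiniteRange v → ∃ ρ₀ : ℝ, 0 < ρ₀ ∧ ∀ ρ : ℝ, 0 < ρ → ρ < ρ₀ → ∃ c : ℝ, 0 < c ∧ ∀ᶠ n : ℕ in Filter.atTop, ∃ δ : ENNReal, 0 < δ ∧ ∀ Ψ : Literature.MathematicalPhysics.QuantumManyBody.BoseGas.TrialState (n + 1) (Literature.MathematicalPhysics.QuantumManyBody.BoseGas.sideLength ρ (n + 1)), Literature.MathematicalPhysics.QuantumManyBody.BoseGas.energy v Ψ ≤ Literature.MathematicalPhysics.QuantumManyBody.BoseGas.groundStateEnergy v (n + 1) (Literature.MathematicalPhysics.QuantumManyBody.BoseGas.sideLength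 ρ (n + 1)) + δ → ENNReal.ofReal c ≤ ∫⁻ Y : Literature.MathematicalPhysics.QuantumManyBody.BoseGas.Config n, ∫⁻ Y' : Literature.MathematicalPhysics.QuantumManyBody.BoseGas.Config n, (‖∫ x, (starRingEnd ℂ) (Ψ.ψ (Matrix.vecCons x Y')) * Ψ.ψ (Matrix.vecCons x Y)‖₊ : ENNReal) ^ 2

/-- item stmt-AtomisticToContinuum-3894 · crux · rank 2 · closed · moot by None · by planner
why it might fail: Asserts a fidelity susceptibility bounded uniformly down to k~π/L: needs inverse-square spectral moments of density fluctuations, i.e. a Landau-type lower bound ω(k) ≳ |k| at thermodynamic scales (open beyond GP scaling, Seiringer2011) plus control beyond 2nd order (GN pair channel).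
sources: Anderson1967, GebertKuttlerMuller2014, GebertEtAl2016, GuentherEtAl2021, Seiringer2011, Literature.Barriers.AtomisticToContinuum.BogoliubovPerturbationInfrared
[crux] NO ORTHOGONALITY CATASTROPHE ALONG THE SWAP PATH (card S2/S3 in fidelity form; bounded
finite-range v). Two copies of the box Λ_L^N (N = n+1, L = (N/ρ)^(1/3)); tag particle 0 of each copy
(a = x₀, b = y₀). For s ∈ [0,1] let E2(s) be the Dirichlet quadratic form on Λ^N × Λ^N with
potential W_s = [bath A pairs] + [bath B pairs] + Σ_(j≥1) (1−s)(v(a−x_j) + v(b−y_j)) + s(v(b−x_j) +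
v(a−y_j)) (H(0) = H⊕H, H(1) = F H(0) F, H(s) stoquastic, F H(s) F = H(1−s)). Claim: for every ε > 0
there is ρ₀(ε,v) > 0 such that for 0 < ρ < ρ₀, all large n, all s, s′ ∈ [0,1] and every τ > 0 there
is δ > 0 with: any δ-near-minimisers Θ of E2(s) and Θ′ of E2(s′) (C¹, Dirichlet, normalised) satisfy
|⟨Θ,Θ′⟩|² ≥ 1 − ε(s−s′)² − τ. Ground-state reading: the positive ground states Φ(s) move with
Fubini–Study speed ≤ √ε, i.e. sup_s χ_F(s) → 0 as ρ → 0 UNIFORMLY IN N (Bogoliubov count: χ_F ≈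
ρ∫d³k |v̂(k)|² S(k)/(ω_A(k)+ω_B(k))² + O(√(ρa³)) ≈ C(∫v)²√(ρ/a): integrand ∝ k dk at small k in d =
3, dk/k in d = 1). At (s,s′) = (0,1) it gives SWAP(Ψ₀)² = |⟨Φ(0),FΦ(0)⟩|² ≥ 1 − ε: complete
condensation in the dilute limit. [deps: none] [difficulty: open-problem] [difficulty: open-problem] -/
@[route_item "route-AtomisticToContinuum-BECSwapOverlap"]
def SwapPathRigidity : Prop :=
  ∀ v : ℝ → ENNReal, Literature.MathematicalPhysics.QuantumManyBody.BoseGas.IsRepulsiveFiniteRange v → (∃ M : NNReal, ∀ r, v r ≤ M) → ∀ ε : ℝ, 0 < ε → ∃ ρ₀ : ℝ, 0 < ρ₀ ∧ ∀ ρ : ℝ, 0 < ρ → ρ < ρ₀ → ∀ᶠ n : ℕ in Filter.atTop, let L : ℝ := Literature.MathematicalPhysics.QuantumManyBody.BoseGas.sideLength ρ (n + 1); let E2 : ℝ → (Literature.MathematicalPhysics.QuantumManyBody.BoseGas.Config (n + 1) × Literature.MathematicalPhysics.QuantumManyBody.BoseGas.Config (n + 1) → ℂ) → ENNReal := fun s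 Θ => ∫⁻ Z : Literature.MathematicalPhysics.QuantumManyBody.BoseGas.Config (n + 1) × Literature.MathematicalPhysics.QuantumManyBody.BoseGas.Config (n + 1), (Literature.MathematicalPhysics.QuantumManyBody.BoseGas.kineticDensity (fun X => Θ (X, Z.2)) Z.1 + Literature.MathematicalPhysics.QuantumManyBody.BoseGas.kineticDensity (fun Y => Θ (Z.1, Y)) Z.2 + (Literature.MathematicalPhysics.QuantumManyBody.BoseGas.interaction v (Fin.tail Z.1) + Literature.MathematicalPhysics.QuantumManyBody.BoseGas.interaction v (Fin.tail Z.2) + ∑ j : Fin n, (ENNReal.ofReal (1 - s) * (v (dist (Z.1 0) (Z.1 j.succ)) + v (dist (Z.2 0) (Z.2 j.succ))) + ENNReal.ofReal s * (v (dist (Z.2 0) (Z.1 j.succ)) + v (dist (Z.1 0) (Z.2 j.succ))))) * (‖Θ Z‖₊ : ENNReal) ^ 2); let Adm : (Literature.MathematicalPhysics.QuantumManyBody.BoseGas.Config (n + 1) × Literature.MathematicalPhysics.QuantumManyBody.BoseGas.Config (n + 1) → ℂ) → Prop := fun Θ => ContDiff ℝ 1 Θ ∧ (∀ Z : Literature.MathematicalPhysics.QuantumManyBody.BoseGas.Config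 (n + 1) × Literature.MathematicalPhysics.QuantumManyBody.BoseGas.Config (n + 1), Θ Z ≠ 0 → Z.1 ∈ Literature.MathematicalPhysics.QuantumManyBody.BoseGas.boxN (n + 1) L ∧ Z.2 ∈ Literature.MathematicalPhysics.QuantumManyBody.BoseGas.boxN (n + 1) L) ∧ ∫⁻ Z : Literature.MathematicalPhysics.QuantumManyBody.BoseGas.Config (n + 1) × Literature.MathematicalPhysics.QuantumManyBody.BoseGas.Config (n + 1), (‖Θ Z‖₊ : ENNReal) ^ 2 = 1; ∀ s : ℝ, 0 ≤ s → s ≤ 1 → ∀ s' : ℝ, 0 ≤ s' → s' ≤ 1 → ∀ τ : ℝ, 0 < τ → ∃ δ : ENNReal, 0 < δ ∧ ∀ Θ Θ' : Literature.MathematicalPhysics.QuantumManyBody.BoseGas.Config (n + 1) × Literature.MathematicalPhysics.QuantumManyBody.BoseGas.Config (n + 1) → ℂ, Adm Θ → Adm Θ' → E2 s Θ ≤ (⨅ (Θ'' : Literature.MathematicalPhysics.QuantumManyBody.BoseGas.Config (n + 1) × Literature.MathematicalPhysics.QuantumManyBody.BoseGas.Config (n + 1) → ℂ) (_ : Adm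 Θ''), E2 s Θ'') + δ → E2 s' Θ' ≤ (⨅ (Θ'' : Literature.MathematicalPhysics.QuantumManyBody.BoseGas.Config (n + 1) × Literature.MathematicalPhysics.QuantumManyBody.BoseGas.Config (n + 1) → ℂ) (_ : Adm Θ''), E2 s' Θ'') + δ → ENNReal.ofReal (1 - ε * (s - s') ^ 2 - τ) ≤ (‖∫ Z : Literature.MathematicalPhysics.QuantumManyBody.BoseGas.Config (n + 1) × Literature.MathematicalPhysics.QuantumManyBody.BoseGas.Config (n + 1), (starRingEnd ℂ) (Θ Z) * Θ' Z‖₊ : ENNReal) ^ 2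

/-- item stmt-AtomisticToContinuum-3895 · crux · rank 3 · closed · moot by None · by planner
why it might fail: No uniform-in-N overlap of 2N-body ground states differing by an O(1) local defect has ever been controlled for an interacting continuum gas; two gapless baths; if 1−α² keeps a v-dependent O(1) piece as ρ→0 (UV of the half-coupled pair) the ½ threshold is missed.
sources: Anderson1967, GebertKuttlerMuller2014, GuentherEtAl2021, EisenbergLieb2002, PenroseOnsager1956
[crux] THE HALF-SWAPPED GROUND STATE REMEMBERS THE PRODUCT (integrated AOC statement; bounded
finite-range v). With E2(½) the F-SYMMETRIC midpoint form of crux 2 (each tagged particle coupled at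
half strength to BOTH baths): there are ρ₀(v) > 0 and, for 0 < ρ < ρ₀, some η > 0 such that for all
large n there is δ > 0 with: for every δ-near-minimiser Ψ of the one-copy Dirichlet energy and every
F-symmetric (Θ∘F = Θ, F: x₀ ↔ y₀), C¹, Dirichlet, normalised δ-near-minimiser Θ of E2(½) within the
F-symmetric class, |⟨Θ, Ψ⊗Ψ⟩|² ≥ ½ + η. Midpoint lemma (pure Hilbert-space algebra, F a unitary
involution, Θ F-invariant unit vector): ⟨Φ,FΦ⟩ ≥ 2|⟨Θ,Φ⟩|² − 1, so this crux gives SWAP(Ψ) ≥ 2η for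
bounded v with NO spectral input in the glue; it is implied by crux 2 (chord from s = 0 to ½) given
the fixed-(n,L) Perron–Frobenius facts. Ground-state reading: α² = |⟨Ψ₀⊗Ψ₀, Φ(½)⟩|² > ½ — two
independent condensates and the system in which one pair is shared half-half cannot be told apart
(expected 1 − α² = O(C(v)√ρ)). [deps: none] [difficulty: open-problem] [difficulty: open-problem] -/
@[route_item "route-AtomisticToContinuum-BECSwapOverlap"]
def HalfSwapOverlap : Prop :=
  ∀ v : ℝ → ENNReal, Literature.MathematicalPhysics.QuantumManyBody.BoseGas.IsRepulsiveFiniteRange v → (∃ M : NNReal, ∀ r, v r ≤ M) → ∃ ρ₀ : ℝ, 0 < ρ₀ ∧ ∀ ρ : ℝ, 0 < ρ → ρ < ρ₀ → ∃ η : ℝ, 0 < η ∧ ∀ᶠ n : ℕ in Filter.atTop, let L : ℝ := Literature.MathematicalPhysics.QuantumManyBody.BoseGas.sideLength ρ (n + 1); let E2 : (Literature.MathematicalPhysics.QuantumManyBody.BoseGas.Config (n + 1) × Literature.MathematicalPhysics.QuantumManyBody.BoseGas.Config (n + 1) → ℂ) → ENNReal := fun Θ => ∫⁻ Z : Literature.MathematicalPhysics.QuantumManyBody.BoseGas.Config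 (n + 1) × Literature.MathematicalPhysics.QuantumManyBody.BoseGas.Config (n + 1), (Literature.MathematicalPhysics.QuantumManyBody.BoseGas.kineticDensity (fun X => Θ (X, Z.2)) Z.1 + Literature.MathematicalPhysics.QuantumManyBody.BoseGas.kineticDensity (fun Y => Θ (Z.1, Y)) Z.2 + (Literature.MathematicalPhysics.QuantumManyBody.BoseGas.interaction v (Fin.tail Z.1) + Literature.MathematicalPhysics.QuantumManyBody.BoseGas.interaction v (Fin.tail Z.2) + ∑ j : Fin n, (2 : ENNReal)⁻¹ * (v (dist (Z.1 0) (Z.1 j.succ)) + v (dist (Z.2 0) (Z.2 j.succ)) + v (dist (Z.2 0) (Z.1 j.succ)) + v (dist (Z.1 0) (Z.2 j.succ)))) * (‖Θ Z‖₊ : ENNReal) ^ 2); let Adm : (Literature.MathematicalPhysics.QuantumManyBody.BoseGas.Config (n + 1) × Literature.MathematicalPhysics.QuantumManyBody.BoseGas.Config (n + 1) → ℂ) → Prop := fun Θ => (ContDiff ℝ 1 Θ ∧ (∀ Z : Literature.MathematicalPhysics.QuantumManyBody.BoseGas.Config (n + 1) × Literature.MathematicalPhysics.QuantumManyBody.BoseGas.Config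 (n + 1), Θ Z ≠ 0 → Z.1 ∈ Literature.MathematicalPhysics.QuantumManyBody.BoseGas.boxN (n + 1) L ∧ Z.2 ∈ Literature.MathematicalPhysics.QuantumManyBody.BoseGas.boxN (n + 1) L) ∧ ∫⁻ Z : Literature.MathematicalPhysics.QuantumManyBody.BoseGas.Config (n + 1) × Literature.MathematicalPhysics.QuantumManyBody.BoseGas.Config (n + 1), (‖Θ Z‖₊ : ENNReal) ^ 2 = 1) ∧ (∀ X Y : Literature.MathematicalPhysics.QuantumManyBody.BoseGas.Config (n + 1), Θ (Matrix.vecCons (Y 0) (Fin.tail X), Matrix.vecCons (X 0) (Fin.tail Y)) = Θ (X, Y)); ∃ δ : ENNReal, 0 < δ ∧ ∀ Ψ : Literature.MathematicalPhysics.QuantumManyBody.BoseGas.TrialState (n + 1) L, Literature.MathematicalPhysics.QuantumManyBody.BoseGas.energy v Ψ ≤ Literature.MathematicalPhysics.QuantumManyBody.BoseGas.groundStateEnergy v (n + 1) L + δ → ∀ Θ : Literature.MathematicalPhysics.QuantumManyBody.BoseGas.Config (n + 1) × Literature.MathematicalPhysics.QuantumManyBody.BoseGas.Config (n + 1) → ℂ,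 Adm Θ → E2 Θ ≤ (⨅ (Θ' : Literature.MathematicalPhysics.QuantumManyBody.BoseGas.Config (n + 1) × Literature.MathematicalPhysics.QuantumManyBody.BoseGas.Config (n + 1) → ℂ) (_ : Adm Θ'), E2 Θ') + δ → ENNReal.ofReal (1 / 2 + η) ≤ (‖∫ Z : Literature.MathematicalPhysics.QuantumManyBody.BoseGas.Config (n + 1) × Literature.MathematicalPhysics.QuantumManyBody.BoseGas.Config (n + 1), (starRingEnd ℂ) (Θ Z) * (Ψ.ψ Z.1 * Ψ.ψ Z.2)‖₊ : ENNReal) ^ 2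

/-- item stmt-AtomisticToContinuum-3896 · crux · rank 4 · closed · moot by None · by planner
why it might fail: True for the ideal gas it is NOT (GuentherEtAl2021): the bound must come from S(k)≲|k| and ω(k)≳|k| of the interacting gas down to k~π/L, an O(1)-precision inhomogeneous response estimate inside an O(N) energy — no such uniform-in-L estimate exists.
sources: GuentherEtAl2021, MysliwySeiringer2020, Anderson1967, PitaevskiiStringari1991, Literature.Barriers.AtomisticToContinuum.KineticGapLengthScales
[crux] FIRST RUNG: NO CATASTROPHE FOR A STATIC IMPURITY IN THE DILUTE INTERACTING GAS, UNIFORMLY IN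
THE VOLUME (bounded finite-range v). One copy, Dirichlet box, N bosons, plus a static impurity at z
∈ ℝ³ coupled through the SAME pair potential with strength t: E_t(Θ) = energy v Θ + t∫Σ_j
v(z−x_j)|Θ|². Claim: for every ε > 0 there is ρ₀(ε,v) such that for 0 < ρ < ρ₀, all large N, all z,
all t,t′ ∈ [0,1] and every τ > 0 there is δ > 0 with: δ-near-minimisers Θ of E_t and Θ′ of E_t′ (in
TrialState N L) satisfy |⟨Θ,Θ′⟩|² ≥ 1 − ε(t−t′)² − τ. Ground-state reading: the infinite-mass
Bose-polaron residue Z_N(z,t) → 1 as ρ → 0 uniformly in N and z (displaced-phonon exponent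
ρ∫d³k|v̂(k)|²S(k)/ω(k)² ∝ (∫v)²√(ρ/a) in d = 3; it DIVERGES for the ideal gas (S ≡ 1, ω = k²) and in
d = 1 — so any proof must use the hyperuniformity of the interacting ground state quantitatively).
The worst case of the engine (no recoil, one bath); test-bed for the technology of cruxes 2–3, not
on the assembly path. [deps: none] [difficulty: XL] [difficulty: XL] -/
@[route_item "route-AtomisticToContinuum-BECSwapOverlap"]
def StaticImpurityRigidity : Prop :=
  ∀ v : ℝ → ENNReal, Literature.MathematicalPhysics.QuantumManyBody.BoseGas.IsRepulsiveFiniteRange v → (∃ M : NNReal, ∀ r, v r ≤ M) → ∀ ε : ℝ, 0 < ε → ∃ ρ₀ : ℝ, 0 < ρ₀ ∧ ∀ ρ : ℝ, 0 < ρ → ρ < ρ₀ → ∀ᶠ N : ℕ in Filter.atTop, let L : ℝ := Literature.MathematicalPhysics.QuantumManyBody.BoseGas.sideLength ρ N; let Et : Literature.MathematicalPhysics.QuantumManyBody.BoseGas.Space → ℝ → Literature.MathematicalPhysics.QuantumManyBody.BoseGas.TrialState N L → ENNReal := fun z t Θ => Literature.MathematicalPhysics.QuantumManyBody.BoseGas.energy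 v Θ + ENNReal.ofReal t * ∫⁻ X : Literature.MathematicalPhysics.QuantumManyBody.BoseGas.Config N, (∑ j : Fin N, v (dist z (X j))) * (‖Θ.ψ X‖₊ : ENNReal) ^ 2; ∀ z : Literature.MathematicalPhysics.QuantumManyBody.BoseGas.Space, ∀ t : ℝ, 0 ≤ t → t ≤ 1 → ∀ t' : ℝ, 0 ≤ t' → t' ≤ 1 → ∀ τ : ℝ, 0 < τ → ∃ δ : ENNReal, 0 < δ ∧ ∀ Θ Θ' : Literature.MathematicalPhysics.QuantumManyBody.BoseGas.TrialState N L, Et z t Θ ≤ (⨅ Θ'' : Literature.MathematicalPhysics.QuantumManyBody.BoseGas.TrialState N L, Et z t Θ'') + δ → Et z t' Θ' ≤ (⨅ Θ'' : Literature.MathematicalPhysics.QuantumManyBody.BoseGas.TrialState N L, Et z t' Θ'') + δ → ENNReal.ofReal (1 - ε * (t - t') ^ 2 - τ) ≤ (‖∫ X : Literature.MathematicalPhysics.QuantumManyBody.BoseGas.Config N, (starRingEnd ℂ) (Θ.ψ X) * Θ'.ψ X‖₊ : ENNReal) ^ 2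

/-- item stmt-AtomisticToContinuum-3897 · support · rank 9 · closed · moot by None · by planner
sources: PenroseOnsager1956, LiebSeiringerSolovejYngvason2005
[support] P–O criterion II in variational clothing: for every N = n+1, L and every admissible Ψ,
(n+1)·SWAP(Ψ) ≤ maxOccupation (n+1) Ψ.ψ, i.e. λ_max(γ) ≥ tr γ²/tr γ. Proof: for each Y′ with w(Y′) =
‖Ψ(·,Y′)‖² > 0 the normalised mode φ_Y′ = Ψ(·,Y′)/√w(Y′) has occupation (n+1)·g(Y′)/w(Y′), g(Y′) =
∫dY |⟨Ψ(·,Y′),Ψ(·,Y)⟩|²; hence g ≤ w·maxOcc/(n+1) pointwise (g = 0 where w = 0 by continuity), and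
Tonelli + ∫w = 1 give SWAP = ∫g ≤ maxOcc/(n+1). No spectral theorem needed. [difficulty:
provable-now] [difficulty: provable-now] -/
@[route_item "route-AtomisticToContinuum-BECSwapOverlap"]
def PenroseOnsagerII : Prop :=
  ∀ (n : ℕ) (L : ℝ) (Ψ : Literature.MathematicalPhysics.QuantumManyBody.BoseGas.TrialState (n + 1) L), ((n + 1 : ℕ) : ENNReal) * (∫⁻ Y : Literature.MathematicalPhysics.QuantumManyBody.BoseGas.Config n, ∫⁻ Y' : Literature.MathematicalPhysics.QuantumManyBody.BoseGas.Config n, (‖∫ x, (starRingEnd ℂ) (Ψ.ψ (Matrix.vecCons x Y')) * Ψ.ψ (Matrix.vecCons x Y)‖₊ : ENNReal) ^ 2) ≤ Literature.MathematicalPhysics.QuantumManyBody.BoseGas.maxOccupation (n + 1) Ψ.ψ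

/-- item stmt-AtomisticToContinuum-3898 · assembly · rank 1 · closed · moot by None · by planner
sources: PenroseOnsager1956, LiebSeiringerSolovejYngvason2005
[assembly] PenroseOnsagerII → SwapOverlapBound → BoseEinsteinCondensation (ENNReal arithmetic,
Filter.atTop shift n ↦ n+1, le_condensateNumber). -/
@[route_item "route-AtomisticToContinuum-BECSwapOverlap"]
def Assembly : Prop :=
  PenroseOnsagerII → SwapOverlapBound → Literature.MathematicalPhysics.QuantumManyBody.BoseGas.BoseEinsteinCondensation

end Summit.AtomisticToContinuum.BoseEinsteinCondensation.Theses.BECSwapOverlap
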